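import Summits.PneNP.PneNP.Theorems.RamseyUncertifiableSosUncertaintyDefs
import Mathlib.LinearAlgebra.Matrix.PosDef
import Mathlib.LinearAlgebra.Matrix.Hadamard
import Mathlib.Analysis.Matrix.Order
import Mathlib.Combinatorics.SimpleGraph.Clique

/-!
# Route `RamseyUncertifiable`, crux `SosUncertainty` (stmt-PneNP-9815), line
`hadamard-bessel-defect`: level `1` is defect-free

Registered stub `stub_levelOneOrthogonal` of the skeleton
`Summits/PneNP/PneNP/Cruxes/SosUncertainty/Lines/hadamard_bessel_defect.lean` (the case `t = 1`
of the composition), in the vocabulary of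
`Summits/PneNP/PneNP/Theorems/RamseyUncertifiableSosUncertaintyDefs.lean`.

Statement: for a level-`1` certificate pair `Q` (for `(G, w)`) and `Q'` (for `(Gᶜ, w')`) the
Hadamard product of the singleton cosine matrices satisfies `1 − cosMatrix Q ⊙ cosMatrix Q' ⪰ 0`.
This is Lovász's `ϑ(G) ϑ(Ḡ) ≥ n` (1979, Corollary 2) read on the certificate side.

Proof: a level-`1` index is `∅` or a singleton, so for `u ≠ v` the only index pairs `(I, J)` with
`I ∪ J = {u, v}` are `({u}, {v})` and `({v}, {u})`; hence the union sum of `Q` at `{u, v}` is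
`Q_{uv} + Q_{vu} = 2 Q_{uv}` (`Q` symmetric). On a non-edge `uv` of `G` the pair is stable, so the
certificate forces `Q_{uv} = 0`, i.e. `(cosMatrix Q)_{uv} = 0`; on an edge of `G` (a non-edge of
`Gᶜ`) likewise `(cosMatrix Q')_{uv} = 0`. So `cosMatrix Q ⊙ cosMatrix Q'` is diagonal with
entries `Q_{uu}/(√Q_{uu})² · Q'_{uu}/(√Q'_{uu})² ∈ {0, 1}`, and `1 − cosMatrix Q ⊙ cosMatrix Q'` is a
diagonal matrix with entries in `{0, 1}`, positive semidefinite by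
`Matrix.posSemidef_diagonal_iff`. Only Mathlib and the Defs file are used.
-/

open scoped BigOperators Matrix

namespace Summit.PneNP.PneNP.Cruxes.SosUncertainty.HadamardBesselDefect

set_option linter.dupNamespace false -- `Summit.PneNP.PneNP.…`: summit = sub-problem name (D-0017)

open Finset Matrix

variable {V : Type*} [Fintype V] [DecidableEq V]

/-- A double sum of `f I J` over the index pairs `(I, J) ∈ {(a, b), (b, a)}` (`a ≠ b`), written with
an arbitrary decidable predicate `P` cutting out these two pairs, equals `f a b + f b a`.
[folklore] -/
private theorem sum_sum_ite_eq_pair {ι : Type*} [Fintype ι] (f : ι → ι → ℝ) {a b : ι}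
    (hab : a ≠ b) (P : ι → ι → Prop) [∀ I J, Decidable (P I J)]
    (hP : ∀ I J, P I J ↔ (I = a ∧ J = b) ∨ (I = b ∧ J = a)) :
    (∑ I, ∑ J, if P I J then f I J else 0) = f a b + f b a := by
  rw [Fintype.sum_eq_add a b hab]
  · congr 1
    · rw [Fintype.sum_eq_single b]
      · rw [if_pos ((hP a b).2 (Or.inl ⟨rfl, rfl⟩))]
      · intro J hJ
        rw [if_neg]
        rw [hP]
        rintro (⟨-, h⟩ | ⟨h, -⟩)
        · exact hJ h
        · exact hab h
    · rw [Fintype.sum_eq_single a]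
      · rw [if_pos ((hP b a).2 (Or.inr ⟨rfl, rfl⟩))]
      · intro J hJ
        rw [if_neg]
        rw [hP]
        rintro (⟨h, -⟩ | ⟨-, h⟩)
        · exact hab h.symm
        · exact hJ h
  · rintro I ⟨hIa, hIb⟩
    refine Finset.sum_eq_zero fun J _ => ?_
    rw [if_neg]
    rw [hP]
    rintro (⟨h, -⟩ | ⟨h, -⟩)
    · exact hIa h
    · exact hIb h

omit [Fintype V] in
/-- At level `1`, for `u ≠ v`, the index pairs `(I, J)` with `I ∪ J = {u, v}` are exactly
`({u}, {v})` and `({v}, {u})` (an index has at most one element). [folklore] -/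
theorem union_eq_pair_iff {u v : V} (huv : u ≠ v) (I J : Idx V 1) :
    I.1 ∪ J.1 = {u, v} ↔
      (I = vtx 1 le_rfl u ∧ J = vtx 1 le_rfl v) ∨ (I = vtx 1 le_rfl v ∧ J = vtx 1 le_rfl u) := by
  constructor
  · intro h
    have hc : (I.1 ∪ J.1).card = 2 := by rw [h, Finset.card_pair huv]
    have hle : (I.1 ∪ J.1).card ≤ I.1.card + J.1.card := Finset.card_union_le I.1 J.1
    have hI2 := I.2
    have hJ2 := J.2
    obtain ⟨a, ha⟩ := Finset.card_eq_one.1 (show I.1.card = 1 by omega)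
    obtain ⟨b, hb⟩ := Finset.card_eq_one.1 (show J.1.card = 1 by omega)
    have hIa : I = vtx 1 le_rfl a := Subtype.ext ha
    have hJb : J = vtx 1 le_rfl b := Subtype.ext hb
    rw [ha, hb, ← Finset.insert_eq] at h
    have h' : ({a, b} : Set V) = {u, v} := by rw [← Finset.coe_pair, h, Finset.coe_pair]
    rcases Set.pair_eq_pair_iff.1 h' with ⟨hau, hbv⟩ | ⟨hav, hbu⟩
    · left
      rw [← hau, ← hbv]
      exact ⟨hIa, hJb⟩
    · right
      rw [← hav, ← hbu]
      exact ⟨hIa, hJb⟩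
  · rintro (⟨rfl, rfl⟩ | ⟨rfl, rfl⟩)
    · show ({u} : Finset V) ∪ {v} = {u, v}
      exact (Finset.insert_eq u {v}).symm
    · show ({v} : Finset V) ∪ {u} = {u, v}
      rw [Finset.union_comm]
      exact (Finset.insert_eq u {v}).symm

/-- At level `1` the union sum at a pair `{u, v}`, `u ≠ v`, is `Q_{uv} + Q_{vu}`. [folklore] -/
theorem unionSum_pair_one (Q : Matrix (Idx V 1) (Idx V 1) ℝ) {u v : V} (huv : u ≠ v) :
    unionSum Q {u, v} = vtxEntry Q u v + vtxEntry Q v u := by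
  have hab : vtx 1 le_rfl u ≠ vtx 1 le_rfl v := fun h =>
    huv (Finset.singleton_injective (congrArg Subtype.val h))
  unfold unionSum vtxEntry
  rw [dif_pos le_rfl]
  exact sum_sum_ite_eq_pair (fun I J => Q I J) hab _ (union_eq_pair_iff huv)

/-- On a `G`-stable pair `u ≠ v` the singleton cosine entry of a level-`1` certificate for `G`
vanishes: the certificate identity at the stable set `{u, v}` reads `2 Q_{uv} = 0`. [folklore] -/
theorem cosMatrix_apply_eq_zero_of_not_adj {G : SimpleGraph V} {w : V → ℝ}
    {Q : Matrix (Idx V 1) (Idx V 1) ℝ} (hQ : IsCertificate G 1 w Q) {u v : V} (huv : u ≠ v)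
    (h : ¬G.Adj u v) : cosMatrix Q u v = 0 := by
  have hsym : vtxEntry Q v u = vtxEntry Q u v := by
    unfold vtxEntry
    rw [dif_pos le_rfl]
    have h1 := hQ.posSemidef.isHermitian.apply (vtx 1 le_rfl u) (vtx 1 le_rfl v)
    rwa [star_trivial] at h1
  have hind : G.IsIndepSet ((({u, v} : Finset V)) : Set V) := by
    rw [Finset.coe_pair, SimpleGraph.isIndepSet_iff, Set.pairwise_pair]
    exact fun _ => ⟨h, fun h' => h (G.adj_symm h')⟩
  have h0 := hQ.indep {u, v} (by rw [Finset.card_pair huv]) hind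
  rw [unionSum_pair_one Q huv, hsym] at h0
  have h1 : vtxEntry Q u v = 0 := by linarith
  rw [cosMatrix, Matrix.of_apply, h1, zero_div]

omit [Fintype V] [DecidableEq V] in
/-- Diagonal singleton cosine entries of a positive semidefinite `Q` are `0` or `1`:
`Q_{uu}/(√Q_{uu} · √Q_{uu})` with `Q_{uu} ≥ 0` (and `x/0 = 0`). [folklore] -/
theorem cosMatrix_apply_self {t : ℕ} {Q : Matrix (Idx V t) (Idx V t) ℝ} (hQ : Q.PosSemidef)
    (u : V) : cosMatrix Q u u = 0 ∨ cosMatrix Q u u = 1 := by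
  have hq : 0 ≤ vtxEntry Q u u := by
    unfold vtxEntry
    split_ifs with ht
    · exact hQ.diag_nonneg
    · exact le_rfl
  rw [cosMatrix, Matrix.of_apply, Real.mul_self_sqrt hq]
  by_cases h0 : vtxEntry Q u u = 0
  · exact Or.inl (by rw [h0, zero_div])
  · exact Or.inr (div_self h0)

/-- **Level `1` is defect-free** (stub `stub_levelOneOrthogonal` of the line
`hadamard-bessel-defect`, crux stmt-PneNP-9815; Lovász 1979, Corollary 2, on the certificate
side): for a level-`1` certificate pair `Q` for `(G, w)` and `Q'` for `(Gᶜ, w')`, the matrix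
`1 − cosMatrix Q ⊙ cosMatrix Q'` is positive semidefinite. Indeed the Hadamard product vanishes
off the diagonal (every pair `u ≠ v` is stable in `G` or in `Gᶜ`) and its diagonal entries lie in
`{0, 1}`, so the difference is a diagonal matrix with entries in `{0, 1}`. [folklore] -/
theorem stub_levelOneOrthogonal :
    ∀ (n : ℕ) (G : SimpleGraph (Fin n)) (w w' : Fin n → ℝ)
      (Q Q' : Matrix (Idx (Fin n) 1) (Idx (Fin n) 1) ℝ),
      IsCertificate G 1 w Q → IsCertificate Gᶜ 1 w' Q' →
        ((1 : Matrix (Fin n) (Fin n) ℝ) - cosMatrix Q ⊙ cosMatrix Q').PosSemidef := by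
  intro n G w w' Q Q' hQ hQ'
  -- off-diagonal entries of the Hadamard product vanish
  have hoff : ∀ u v : Fin n, u ≠ v → (cosMatrix Q ⊙ cosMatrix Q') u v = 0 := by
    intro u v huv
    rw [Matrix.hadamard_apply]
    by_cases hadj : G.Adj u v
    · have hc : ¬Gᶜ.Adj u v := by
        rw [SimpleGraph.compl_adj]
        exact fun h' => h'.2 hadj
      rw [cosMatrix_apply_eq_zero_of_not_adj hQ' huv hc, mul_zero]
    · rw [cosMatrix_apply_eq_zero_of_not_adj hQ huv hadj, zero_mul]
  -- diagonal entries of the Hadamard product lie in `{0, 1}`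
  have hdiag : ∀ u : Fin n, 0 ≤ 1 - (cosMatrix Q ⊙ cosMatrix Q') u u := by
    intro u
    rw [Matrix.hadamard_apply]
    rcases cosMatrix_apply_self hQ.posSemidef u with h | h <;>
      rcases cosMatrix_apply_self hQ'.posSemidef u with h' | h' <;>
        rw [h, h'] <;> norm_num
  -- hence `1 - C ⊙ C'` is a diagonal matrix with nonnegative diagonal
  have heq : (1 : Matrix (Fin n) (Fin n) ℝ) - cosMatrix Q ⊙ cosMatrix Q'
      = Matrix.diagonal fun u => 1 - (cosMatrix Q ⊙ cosMatrix Q') u u := by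
    ext u v
    by_cases h : u = v
    · subst h
      rw [Matrix.sub_apply, Matrix.diagonal_apply_eq, Matrix.one_apply_eq]
    · rw [Matrix.sub_apply, Matrix.diagonal_apply_ne _ h, Matrix.one_apply_ne h, hoff u v h,
        sub_zero]
  rw [heq, Matrix.posSemidef_diagonal_iff]
  exact hdiag

end Summit.PneNP.PneNP.Cruxes.SosUncertainty.HadamardBesselDefect
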